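import Summits.KontsevichZagierPeriods.KontsevichZagierPeriods.Theses.ComplexOrientations
import Summits.KontsevichZagierPeriods.KontsevichZagierPeriods.Theses.AbelContraction
import Summits.KontsevichZagierPeriods.KontsevichZagierPeriods.Theorems.ComplexOrientationsOrientationKernelDimensionOneMerge
import Summits.KontsevichZagierPeriods.KontsevichZagierPeriods.Theorems.ComplexOrientationsOrientationKernelSectorReductionNecessity
import Summits.KontsevichZagierPeriods.KontsevichZagierPeriods.Theorems.ComplexOrientationsCauchyMove
import Summits.KontsevichZagierPeriods.KontsevichZagierPeriods.Theorems.SymplecticScissorsPlanarAreasStubAreaSlicing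
import Summits.KontsevichZagierPeriods.KontsevichZagierPeriods.Theorems.AbelContractionAreasToArcs

/-!
# Crux `OrientationKernel` (stmt-KontsevichZagierPeriods-11367), line `birth`: the crux implies
`AbelContraction.ReductionToDimensionOne` (stmt-KontsevichZagierPeriods-14403), and the exact cut

The registered skeleton of line `birth` (reshaped by lead c11) proves the crux
`ComplexOrientations.OrientationKernel` — the kernel conjecture of the Kontsevich–Zagier calculus
enlarged by the route's three relator families — from the two stubs
`stub_reductionToDimensionOne` (= item stmt-14403 `AbelContraction.ReductionToDimensionOne`,
verbatim) and `stub_planarAreas` (= item stmt-4990 `PlanarAreas`, verbatim). This file proves the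
converse bookkeeping, so that the crux is parked on stmt-14403 BY THEOREM:

* `mem_of_mem_closure_one_of_eval_eq_zero` — for every subgroup `R ≥ KZ.relations` containing
  `[r] − [r']` for all equal-valued one-dimensional `r, r'`, every element of
  `closure {[s] | s : IntegralRep 1}` with value `0` lies in `R` (it is `≡ [a] − [b]`,
  `exists_pair_of_mem_closure_one`, and soundness gives `a.value = b.value`);
* `planarPair_mem`, `planarCombination_mem` — hence every difference / integer combination of
  planar integrand-`1` representations with vanishing total value lies in such an `R` (area
  slicing `SymplecticScissors.PlanarAreas.stub_areaSlicing`, landed: a planar integrand-`1`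
  representation is `≡` a `ℤ`-combination of one-dimensional classes);
* `reductionToDimensionOne_of_orientationKernel` — **`OrientationKernel → ReductionToDimensionOne`**:
  an `R` as above contains the oval relators of families (i), (ii) (`planarCombination_mem`) and
  the Cauchy relators of family (iii) (they lie in `KZ.relations`: `cauchyMove_proof`, landed), so
  the crux applies to `R`;
* `sectorReduction_iff_reductionToDimensionOne` — the registrar's original hardest stub
  `stub_sectorReduction` is EQUIVALENT to `ReductionToDimensionOne`;
* `orientationKernel_of_reductionToDimensionOne_of_planarAreas` — the skeleton's composition as a
  closed theorem (`ReductionToDimensionOne → PlanarAreas → OrientationKernel`), and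
  `orientationKernel_iff_reductionToDimensionOne_of_planarAreas` — modulo the 1-period layer
  `PlanarAreas` (stmt-4990) the crux IS stmt-14403.

Logical position recorded in the tree after this file: `KZ kernel form → OrientationKernel →
ReductionToDimensionOne`, `ReductionToDimensionOne ∧ PlanarAreas → OrientationKernel`, and (with
`orientationKernel_iff_sectorReduction_and_sectorKernel`, landed) `OrientationKernel ↔
ReductionToDimensionOne ∧ SectorKernel`. No definitions, no named facts, no transcendence input.

References: M. Kontsevich, D. Zagier, *Periods* (2001), §1.2; A. Huber, G. Wüstholz,
*Transcendence and linear relations of 1-periods* (2022) (the 1-period layer).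
-/

noncomputable section

open Literature.NumberTheory.Transcendental

namespace Summit.KontsevichZagierPeriods.ComplexOrientations.OrientationKernel

/-- **One-dimensional vanishing combinations lie in every admissible `R`.** If `R ≥ KZ.relations`
contains `[r] − [r']` for all one-dimensional `r, r'` of equal value, then every element of the
subgroup generated by the one-dimensional classes whose value is `0` lies in `R`: it is congruent
to a pair `[a] − [b]` (`exists_pair_of_mem_closure_one`), and `a.value = b.value` by soundness of
the moves. [Kontsevich–Zagier 2001, §1.2] -/
theorem mem_of_mem_closure_one_of_eval_eq_zero (R : AddSubgroup KZ.FormalRep)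
    (hRel : KZ.relations ≤ R)
    (h1 : ∀ (r r' : KZ.IntegralRep 1), r.value = r'.value → KZ.of r - KZ.of r' ∈ R)
    {c : KZ.FormalRep} (hc : c ∈ AddSubgroup.closure (Set.range fun s : KZ.IntegralRep 1 => KZ.of s))
    (hc0 : KZ.eval c = 0) : c ∈ R := by
  obtain ⟨a, b, hab⟩ := exists_pair_of_mem_closure_one c hc
  have hval : a.value = b.value := by
    have h : KZ.eval (c - (KZ.of a - KZ.of b)) = 0 := KZ.relations_le_ker_eval_holds hab
    rwa [map_sub, map_sub, KZ.eval_of, KZ.eval_of, hc0, zero_sub, neg_eq_zero, sub_eq_zero] at h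
  simpa using R.add_mem (hRel hab) (h1 a b hval)

/-- **Equal-area planar pairs lie in every admissible `R`.** For `R` as above and two planar
representations `A`, `B` with integrand `1` and equal value, `[A] − [B] ∈ R`: slice both into
`ℤ`-combinations of one-dimensional classes (`stub_areaSlicing`, rules (1), (3)) and apply
`mem_of_mem_closure_one_of_eval_eq_zero`. [Kontsevich–Zagier 2001, §1.2] -/
theorem planarPair_mem (R : AddSubgroup KZ.FormalRep) (hRel : KZ.relations ≤ R)
    (h1 : ∀ (r r' : KZ.IntegralRep 1), r.value = r'.value → KZ.of r - KZ.of r' ∈ R)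
    (A B : KZ.IntegralRep 2) (hA : ∀ v ∈ A.domain, A.integrand v = 1)
    (hB : ∀ v ∈ B.domain, B.integrand v = 1) (hAB : A.value = B.value) :
    KZ.of A - KZ.of B ∈ R := by
  obtain ⟨cA, hcA, hAc⟩ := SymplecticScissors.PlanarAreas.stub_areaSlicing A hA
  obtain ⟨cB, hcB, hBc⟩ := SymplecticScissors.PlanarAreas.stub_areaSlicing B hB
  have hdiff : KZ.of A - KZ.of B - (cA - cB) ∈ KZ.relations := by
    have : KZ.of A - KZ.of B - (cA - cB) = (KZ.of A - cA) - (KZ.of B - cB) := by abel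
    rw [this]
    exact KZ.relations.sub_mem hAc hBc
  have h0 : KZ.eval (cA - cB) = 0 := by
    have h : KZ.eval (KZ.of A - KZ.of B - (cA - cB)) = 0 := KZ.relations_le_ker_eval_holds hdiff
    rwa [map_sub, map_sub, KZ.eval_of, KZ.eval_of, hAB, sub_self, zero_sub, neg_eq_zero] at h
  have hC : cA - cB ∈ R :=
    mem_of_mem_closure_one_of_eval_eq_zero R hRel h1 (AddSubgroup.sub_mem _ hcA hcB) h0
  simpa using R.add_mem (hRel hdiff) hC

/-- **Vanishing integer combinations of planar integrand-`1` classes lie in every admissible `R`.**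
For `R` as above, planar representations `sᵢ` (`i < k`) and `e` with integrand `1` and integers
`nᵢ` with `∑ nᵢ · vol sᵢ = vol e`, the combination `∑ nᵢ • [sᵢ] − [e]` lies in `R` (slice every
term, `stub_areaSlicing`, and apply `mem_of_mem_closure_one_of_eval_eq_zero`). This is the shape of
the oval relators of families (i) and (ii) of the crux. [Kontsevich–Zagier 2001, §1.2] -/
theorem planarCombination_mem (R : AddSubgroup KZ.FormalRep) (hRel : KZ.relations ≤ R)
    (h1 : ∀ (r r' : KZ.IntegralRep 1), r.value = r'.value → KZ.of r - KZ.of r' ∈ R)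
    {k : ℕ} (s : Fin k → KZ.IntegralRep 2) (hs : ∀ i, ∀ v ∈ (s i).domain, (s i).integrand v = 1)
    (n : Fin k → ℤ) (e : KZ.IntegralRep 2) (he : ∀ v ∈ e.domain, e.integrand v = 1)
    (hval : ∑ i, (n i : ℝ) * (s i).value = e.value) :
    (∑ i, n i • KZ.of (s i)) - KZ.of e ∈ R := by
  classical
  choose c hc hsc using fun i => SymplecticScissors.PlanarAreas.stub_areaSlicing (s i) (hs i)
  obtain ⟨ce, hce, hece⟩ := SymplecticScissors.PlanarAreas.stub_areaSlicing e he
  set C : KZ.FormalRep := (∑ i, n i • c i) - ce with hC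
  have hCmem : C ∈ AddSubgroup.closure (Set.range fun s : KZ.IntegralRep 1 => KZ.of s) :=
    AddSubgroup.sub_mem _ (AddSubgroup.sum_mem _ fun i _ => AddSubgroup.zsmul_mem _ (hc i) _) hce
  have hdiff : (∑ i, n i • KZ.of (s i)) - KZ.of e - C ∈ KZ.relations := by
    have : (∑ i, n i • KZ.of (s i)) - KZ.of e - C =
        (∑ i, n i • (KZ.of (s i) - c i)) - (KZ.of e - ce) := by
      simp only [hC, smul_sub, Finset.sum_sub_distrib]
      abel
    rw [this]
    exact KZ.relations.sub_mem
      (KZ.relations.sum_mem fun i _ => KZ.relations.zsmul_mem (hsc i) _) hece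
  have hy0 : KZ.eval ((∑ i, n i • KZ.of (s i)) - KZ.of e) = 0 := by
    simp only [map_sub, map_sum, map_zsmul, KZ.eval_of, zsmul_eq_mul, hval, sub_self]
  have hC0 : KZ.eval C = 0 := by
    have h : KZ.eval ((∑ i, n i • KZ.of (s i)) - KZ.of e - C) = 0 :=
      KZ.relations_le_ker_eval_holds hdiff
    rwa [map_sub, hy0, zero_sub, neg_eq_zero] at h
  have hCR : C ∈ R := mem_of_mem_closure_one_of_eval_eq_zero R hRel h1 hCmem hC0
  simpa using R.add_mem (hRel hdiff) hCR

/-- **`OrientationKernel → ReductionToDimensionOne` (stmt-14403 is necessary for the crux).**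
Let `R ≥ KZ.relations` contain `[r] − [r']` for all equal-valued one-dimensional `r, r'`. Then `R`
contains the crux's three relator families: the oval combinations of families (i) and (ii) are
vanishing integer combinations of planar integrand-`1` classes (`planarCombination_mem`; the
geometric hypotheses on the curve are not needed), and the Cauchy relators of family (iii) lie in
`KZ.relations ≤ R` by the landed `cauchyMove_proof`. So the crux applied to `R` gives
`ker KZ.eval ⊆ R`, which is `ReductionToDimensionOne` at `R`. [Kontsevich–Zagier 2001, §1.2] -/
theorem reductionToDimensionOne_of_orientationKernel :
    Summit.KontsevichZagierPeriods.KontsevichZagierPeriods.Theses.ComplexOrientations.OrientationKernel →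
    Summit.KontsevichZagierPeriods.KontsevichZagierPeriods.Theses.AbelContraction.ReductionToDimensionOne := by
  intro hK R hRel h1 x hx
  refine hK R hRel ?_ ?_ ?_ x hx
  · intro p _ _ _ _ k O s _ _ _ _ hint η β e _ _ _ _ heint hval
    exact planarCombination_mem R hRel h1 s hint η e heint hval
  · intro p _ _ k O s _ _ _ _ hint n β e _ _ _ heint hval
    exact planarCombination_mem R hRel h1 s hint n e heint hval
  · intro ρ R' g hρ hρR halg hg hP r hdom hint
    exact hRel (Summit.KontsevichZagierPeriods.ComplexOrientations.cauchyMove_proof ρ R' g hρ hρR halg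
      hg hP r hdom hint)

/-- **The registrar's hardest stub is stmt-14403.** `stub_sectorReduction` of line `birth` (every
vanishing combination is congruent modulo the moves to an element of the 1-period sector
`S = closure ({[s] | s : IntegralRep 0} ∪ {[s] | s : IntegralRep 1} ∪ {[s] | s planar, bounded,
integrand 1})`) is equivalent to `AbelContraction.ReductionToDimensionOne`. `→`: reduce `x ≡ y ∈ S`,
merge `y ≡ [A] − [B]` (`stub_sectorMerge`, landed), read `vol A = vol B` off soundness, and
`[A] − [B] ∈ R` by `planarPair_mem`. `←`: `R₀ := KZ.relations ⊔ S` contains every difference of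
one-dimensional classes, so `ReductionToDimensionOne` puts `ker KZ.eval` inside `R₀`
(`AddSubgroup.mem_sup`). [Kontsevich–Zagier 2001, §1.2] -/
theorem sectorReduction_iff_reductionToDimensionOne :
    (∀ x : KZ.FormalRep, KZ.eval x = 0 → ∃ y ∈ AddSubgroup.closure ({c : KZ.FormalRep | ∃ s :
      KZ.IntegralRep 0, c = KZ.of s} ∪ {c : KZ.FormalRep | ∃ s : KZ.IntegralRep 1, c = KZ.of s} ∪ {c
      : KZ.FormalRep | ∃ s : KZ.IntegralRep 2, Bornology.IsBounded s.domain ∧ (∀ v ∈ s.domain,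
      s.integrand v = 1) ∧ c = KZ.of s}), x - y ∈ KZ.relations) ↔
    Summit.KontsevichZagierPeriods.KontsevichZagierPeriods.Theses.AbelContraction.ReductionToDimensionOne := by
  constructor
  · intro hred R hRel h1 x hx
    obtain ⟨y, hyS, hxy⟩ := hred x hx
    obtain ⟨A, B, -, -, hA, hB, hyAB⟩ := stub_sectorMerge y hyS
    have hy0 : KZ.eval y = 0 := by
      have h : KZ.eval (x - y) = 0 := KZ.relations_le_ker_eval_holds hxy
      rwa [map_sub, hx, zero_sub, neg_eq_zero] at h
    have hAB : A.value = B.value := by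
      have h : KZ.eval (y - (KZ.of A - KZ.of B)) = 0 := KZ.relations_le_ker_eval_holds hyAB
      rwa [map_sub, map_sub, KZ.eval_of, KZ.eval_of, hy0, zero_sub, neg_eq_zero, sub_eq_zero] at h
    have hyR : y ∈ R := by
      simpa using R.add_mem (hRel hyAB) (planarPair_mem R hRel h1 A B hA hB hAB)
    simpa using R.add_mem (hRel hxy) hyR
  · intro hRD x hx
    set S : AddSubgroup KZ.FormalRep := AddSubgroup.closure
      ({c : KZ.FormalRep | ∃ s : KZ.IntegralRep 0, c = KZ.of s} ∪
        {c : KZ.FormalRep | ∃ s : KZ.IntegralRep 1, c = KZ.of s} ∪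
        {c : KZ.FormalRep | ∃ s : KZ.IntegralRep 2, Bornology.IsBounded s.domain ∧
          (∀ v ∈ s.domain, s.integrand v = 1) ∧ c = KZ.of s}) with hS_def
    have one_mem : ∀ s : KZ.IntegralRep 1, KZ.of s ∈ S :=
      fun s => AddSubgroup.subset_closure (Or.inl (Or.inr ⟨s, rfl⟩))
    have hxR : x ∈ KZ.relations ⊔ S :=
      hRD (KZ.relations ⊔ S) le_sup_left
        (fun r r' _ => AddSubgroup.mem_sup_right (S.sub_mem (one_mem r) (one_mem r'))) x hx
    obtain ⟨a, ha, b, hb, hab⟩ := AddSubgroup.mem_sup.1 hxR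
    exact ⟨b, hb, by rwa [← hab, add_sub_cancel_right]⟩

/-- **The exact logical position of line `birth`, in terms of existing items**: the crux
`OrientationKernel` is EQUIVALENT to the conjunction of `AbelContraction.ReductionToDimensionOne`
(item stmt-KontsevichZagierPeriods-14403) and of the crux restricted to the 1-period sector
(`SectorKernel`, inlined: every admissible `R` contains the vanishing elements of the sector) —
the landed cut `orientationKernel_iff_sectorReduction_and_sectorKernel` read through
`sectorReduction_iff_reductionToDimensionOne`. `PlanarAreas` (stmt-4990) implies `SectorKernel`
(`sectorKernel_of_boundedPlanarKernel`, `boundedPlanarKernel_of_planarAreas`, landed).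
[Kontsevich–Zagier 2001, §1.2] -/
theorem orientationKernel_iff_reductionToDimensionOne_and_sectorKernel :
    Summit.KontsevichZagierPeriods.KontsevichZagierPeriods.Theses.ComplexOrientations.OrientationKernel ↔
    Summit.KontsevichZagierPeriods.KontsevichZagierPeriods.Theses.AbelContraction.ReductionToDimensionOne ∧
    (∀ R : AddSubgroup KZ.FormalRep, KZ.relations ≤ R → (∀ (p : MvPolynomial (Fin 2) ℚ), IsCompact
      {v : Fin 2 → ℝ | MvPolynomial.aeval v p = 0} → (∀ w : Fin 2 → ℂ, MvPolynomial.aeval w p = 0 →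
      ∃ i, MvPolynomial.aeval w (MvPolynomial.pderiv i p) ≠ 0) → Irreducible (MvPolynomial.map
      (algebraMap ℚ ℂ) p) → ¬ IsPreconnected {w : Fin 2 → ℂ | MvPolynomial.aeval w p = 0 ∧ ∃ i, (w
      i).im ≠ 0} → ∀ (k : ℕ) (O : Fin k → Set (Fin 2 → ℝ)) (s : Fin k → KZ.IntegralRep 2), (∀ i, ∃ v
      : Fin 2 → ℝ, MvPolynomial.aeval v p = 0 ∧ O i = connectedComponentIn {u : Fin 2 → ℝ |
      MvPolynomial.aeval u p = 0} v) → Function.Injective O → (∀ v : Fin 2 → ℝ, MvPolynomial.aeval v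
      p = 0 → ∃ i, v ∈ O i) → (∀ i, (s i).domain = {v : Fin 2 → ℝ | v ∉ O i ∧ Bornology.IsBounded
      (connectedComponentIn (O i)ᶜ v)}) → (∀ i, ∀ v ∈ (s i).domain, (s i).integrand v = 1) → ∀ (η :
      Fin k → ℤ) (β : ℝ) (e : KZ.IntegralRep 2), (∀ i, η i = 1 ∨ η i = -1) → IsAlgebraic ℚ β → 0 ≤ β
      → e.domain = {v : Fin 2 → ℝ | v 0 ^ 2 + v 1 ^ 2 < β} → (∀ v ∈ e.domain, e.integrand v = 1) → ∑
      i, (η i : ℝ) * (s i).value = e.value → (∑ i, η i • KZ.of (s i)) - KZ.of e ∈ R) → (∀ (p :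
      MvPolynomial (Fin 2) ℚ), IsCompact {v : Fin 2 → ℝ | MvPolynomial.aeval v p = 0} → (∀ v : Fin 2
      → ℝ, MvPolynomial.aeval v p = 0 → ∃ i, MvPolynomial.aeval v (MvPolynomial.pderiv i p) ≠ 0) → ∀
      (k : ℕ) (O : Fin k → Set (Fin 2 → ℝ)) (s : Fin k → KZ.IntegralRep 2), (∀ i, ∃ v : Fin 2 → ℝ,
      MvPolynomial.aeval v p = 0 ∧ O i = connectedComponentIn {u : Fin 2 → ℝ | MvPolynomial.aeval u
      p = 0} v) → Function.Injective O → (∀ v : Fin 2 → ℝ, MvPolynomial.aeval v p = 0 → ∃ i, v ∈ O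
      i) → (∀ i, (s i).domain = {v : Fin 2 → ℝ | v ∉ O i ∧ Bornology.IsBounded (connectedComponentIn
      (O i)ᶜ v)}) → (∀ i, ∀ v ∈ (s i).domain, (s i).integrand v = 1) → ∀ (n : Fin k → ℤ) (β : ℝ) (e
      : KZ.IntegralRep 2), IsAlgebraic ℚ β → 0 ≤ β → e.domain = {v : Fin 2 → ℝ | v 0 ^ 2 + v 1 ^ 2 <
      β} → (∀ v ∈ e.domain, e.integrand v = 1) → ∑ i, (n i : ℝ) * (s i).value = e.value → (∑ i, n i
      • KZ.of (s i)) - KZ.of e ∈ R) → (∀ (ρ R' : ℝ) (g : ℂ → ℂ), 0 < ρ → ρ < R' → IsAlgebraic ℚ ρ →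
      DifferentiableOn ℂ g (Metric.ball 0 R') → (∃ P : MvPolynomial (Fin 2) ℚ, P ≠ 0 ∧ ∀ t ∈
      Metric.ball (0 : ℂ) R', MvPolynomial.aeval ![t, g t] P = 0) → ∀ r : KZ.IntegralRep 1, r.domain
      = Set.univ → (∀ z : Fin 1 → ℝ, r.integrand z = (g ((ρ : ℂ) * (1 + (z 0 : ℂ) * Complex.I) / (1
      - (z 0 : ℂ) * Complex.I)) * ((ρ : ℂ) * (2 * Complex.I) / (1 - (z 0 : ℂ) * Complex.I) ^ 2)).re)
      → KZ.of r ∈ R) → ∀ y ∈ AddSubgroup.closure ({c : KZ.FormalRep | ∃ s : KZ.IntegralRep 0, c =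
      KZ.of s} ∪ {c : KZ.FormalRep | ∃ s : KZ.IntegralRep 1, c = KZ.of s} ∪ {c : KZ.FormalRep | ∃ s
      : KZ.IntegralRep 2, Bornology.IsBounded s.domain ∧ (∀ v ∈ s.domain, s.integrand v = 1) ∧ c =
      KZ.of s}), KZ.eval y = 0 → y ∈ R) :=
  orientationKernel_iff_sectorReduction_and_sectorKernel.trans
    (and_congr_left' sectorReduction_iff_reductionToDimensionOne)

/-- **The skeleton's composition, closed**: `ReductionToDimensionOne → PlanarAreas →
OrientationKernel`. The planar kernel gives the one-dimensional kernel by the landed transfer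
`AbelContraction.AreasToArcs.areasToArcs_proof` (a one-dimensional representation is a difference
of two planar bands, rule (3) with primitive `t`), so every `R ≥ KZ.relations` contains
`[r] − [r']` for all equal-valued one-dimensional `r, r'`, and `ReductionToDimensionOne` puts
`ker KZ.eval` inside `R`; the three relator hypotheses are carried, not consumed.
[Kontsevich–Zagier 2001, §1.2] -/
theorem orientationKernel_of_reductionToDimensionOne_of_planarAreas :
    Summit.KontsevichZagierPeriods.KontsevichZagierPeriods.Theses.AbelContraction.ReductionToDimensionOne →
    Summit.KontsevichZagierPeriods.KontsevichZagierPeriods.Theses.AbelContraction.PlanarAreas →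
    Summit.KontsevichZagierPeriods.KontsevichZagierPeriods.Theses.ComplexOrientations.OrientationKernel := by
  intro hred hplanar R hRel _ _ _ x hx
  have hone : ∀ (r r' : KZ.IntegralRep 1), r.value = r'.value → KZ.Equivalent r r' :=
    Summit.KontsevichZagierPeriods.AbelContraction.AreasToArcs.areasToArcs_proof hplanar
  exact hred R hRel (fun r r' hv => hRel (hone r r' hv)) x hx

/-- **Modulo the 1-period layer the crux IS stmt-14403**: under `PlanarAreas` (stmt-4990),
`OrientationKernel ↔ ReductionToDimensionOne` (`reductionToDimensionOne_of_orientationKernel` and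
`orientationKernel_of_reductionToDimensionOne_of_planarAreas`). [Kontsevich–Zagier 2001, §1.2] -/
theorem orientationKernel_iff_reductionToDimensionOne_of_planarAreas
    (hplanar : Summit.KontsevichZagierPeriods.KontsevichZagierPeriods.Theses.AbelContraction.PlanarAreas) :
    Summit.KontsevichZagierPeriods.KontsevichZagierPeriods.Theses.ComplexOrientations.OrientationKernel ↔
    Summit.KontsevichZagierPeriods.KontsevichZagierPeriods.Theses.AbelContraction.ReductionToDimensionOne :=
  ⟨reductionToDimensionOne_of_orientationKernel, fun h =>
    orientationKernel_of_reductionToDimensionOne_of_planarAreas h hplanar⟩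

end Summit.KontsevichZagierPeriods.ComplexOrientations.OrientationKernel

end
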